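import Summits.PneNP.GCT.SufficesForValiant
import Literature.Computability.AlgebraicComplexity.PerDetObstructionKindsNoOccurrence
import HarnessLib

/-!
# What suffices, and what cannot suffice: the hypotheses of `SufficesForValiant.lean` under
# Bürgisser–Ikenmeyer–Panova's no-occurrence theorem

Cell `val-lit` (rung V3, BIP corpus; typed link requested by the ladder director: "typed links for
`Summits/PneNP/GCT/SufficesForValiant.lean` from the existing GCTOccurrenceObstructions* /
BIPNoOccurrence* files"). Companion of `SufficesForValiant.lean` (cell `pub-gct-max`), whose two
hypothesis shapes `MultObstructionsBeyondPoly` / `MultObstructionsBeyondQuasiPoly` ask, for every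
`c`, for ONE multiplicity obstruction `PerDetMultiplicityObstruction (k := ℂ) m n χ`
(`mult_χ ℂ[Δ(det_n)] < mult_χ ℂ[Δ(X₀₀^{n-m} per_m)]`, fresh-variable padding, `m ≤ n`) at a pair
`(per m, det n)` with `n` beyond the template `m^c + c` resp. `2^((log₂ m + c)^c)`, and which PROVES
`MultObstructionsBeyondPoly → DcPerSuperpolynomial ℂ` and `MultObstructionsBeyondQuasiPoly → ValiantsHypothesis`.

HONEST FRAMING: nothing here is a claim on VP vs VNP; the hypotheses are OPEN (no multiplicity
obstruction is known at any pair `(per m, det n)` with `n > m ≥ 3`, Bläser–Ikenmeyer 2025 §12.4).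
This file records, as sorry-free theorems over PROVED tree results, what Bürgisser–Ikenmeyer–Panova
(J. AMS 32 (2019), Thm. 1.4: beyond `n ≥ m^25` every type occurring in the coordinate ring of the
padded permanent's orbit closure occurs in that of `Ω_n`; for the tree's fresh-variable padding the
threshold is `(m+1)^25 ≤ n`, PROVED as
`Literature.Computability.Complexity.no_occurrence_obstructions_succ_holds` and put into
`orbitMultiplicity` letters in `Literature/…/PerDetObstructionKindsNoOccurrence.lean`) says about
these hypotheses. Letters as in `SufficesForValiant.lean`: `m` = permanent size, `n` = determinant
size.

* `MultObstructionsBeyondPoly.genuine` / `multObstructionsBeyondPoly_iff_genuine` and the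
  `QuasiPoly` twins: each hypothesis is EQUIVALENT to its strengthening in which the witnessing
  weight also occurs on the determinant side, `1 ≤ mult_χ ℂ[Δ(det_n)] < mult_χ ℂ[Δ(X₀₀^{n-m} per_m)]`
  (instantiate the hypothesis at the larger constant `max c (2^25)` resp. `max c 25`, where the
  template already exceeds `(m+1)^25`). So the chain of `SufficesForValiant.lean` can only ever be
  fed by GENUINE multiplicity flips — vanishing-ideal or pure obstructions in the typology of
  `ObstructionTypes.lean` (`MultObstructionsBeyondQuasiPoly.kinds`).
* `not_occurrenceObstructionsBeyondPoly`, `not_occurrenceObstructionsBeyondQuasiPoly`: the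
  OCCURRENCE analogues of the two hypotheses (same templates, `IsOccurrenceObstructionAt` in place of
  the flip) are FALSE — refuted at the single constants `c = 2^25` resp. `c = 25`. The negands are
  spelled out; no statement is declared (cf. the retired refuted route shapes of
  `Literature/Barriers/ValiantsHypothesis/GCTOccurrenceObstructions.lean`, module form, BIP's padding).

## References

* P. Bürgisser, C. Ikenmeyer, G. Panova, *No occurrence obstructions in geometric complexity
  theory*, J. Amer. Math. Soc. 32 (2019) 163–193, Thm. 1.4 and §1.4. [BurgisserIkenmeyerPanovaJAMS2019]
* M. Bläser, C. Ikenmeyer, *Introduction to geometric complexity theory*, Theory of Computing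
  Graduate Surveys 10 (2025), §12.4. [BlaeserIkenmeyer2025]
-/

noncomputable section

namespace Summit.PneNP.GCT

open Literature.Computability.AlgebraicComplexity Literature.NumberTheory.DiophantineGeometry

/-! ### Arithmetic of the two templates versus BIP's threshold `(m+1)^25` -/

/-- The polynomial template is monotone in the constant: `m^c + c ≤ m^c' + c'` for `c ≤ c'`
(for `m = 0` by cases on `0^0 = 1`). [folklore] -/
private theorem polyTemplate_mono {c c' : ℕ} (m : ℕ) (h : c ≤ c') : m ^ c + c ≤ m ^ c' + c' := by
  rcases Nat.eq_zero_or_pos m with rfl | hm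
  · rcases Nat.eq_zero_or_pos c with rfl | hc
    · rcases Nat.eq_zero_or_pos c' with rfl | hc'
      · simp
      · rw [zero_pow hc'.ne', pow_zero]; omega
    · rw [zero_pow hc.ne', zero_pow (by omega : c' ≠ 0)]; omega
  · exact add_le_add (Nat.pow_le_pow_right hm h) h

/-- The quasi-polynomial template is monotone in the constant:
`2^((log₂ m + c)^c) ≤ 2^((log₂ m + c')^c')` for `c ≤ c'`. [folklore] -/
private theorem qpTemplate_mono {c c' : ℕ} (m : ℕ) (h : c ≤ c') :
    2 ^ ((Nat.log 2 m + c) ^ c) ≤ 2 ^ ((Nat.log 2 m + c') ^ c') := by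
  refine Nat.pow_le_pow_right (by norm_num) ?_
  rcases Nat.eq_zero_or_pos c with rfl | hc
  · rcases Nat.eq_zero_or_pos c' with rfl | hc'
    · simp
    · simpa using Nat.one_le_pow c' (Nat.log 2 m + c') (by omega)
  · exact (Nat.pow_le_pow_left (by omega) c).trans (Nat.pow_le_pow_right (by omega) h)

/-- BIP's fresh-padding threshold lies below the polynomial template for every constant
`C ≥ 2^25`: `(m+1)^25 ≤ m^C + C` (`m ≥ 2`: `(m+1)^25 ≤ m^50 ≤ m^C`; `m = 1`: `2^25 ≤ 1 + C`;
`m = 0`: `1 ≤ C`). Stated with a symbolic constant: a closed numeral of this size must not meet a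
structured term in a kernel conversion. [folklore] -/
private theorem succ_pow_le_polyTemplate (m : ℕ) {C : ℕ} (hC : 50 ≤ C) (hC' : 2 ^ 25 ≤ C) :
    (m + 1) ^ 25 ≤ m ^ C + C := by
  rcases Nat.lt_or_ge m 2 with hm | hm
  · interval_cases m
    · rw [zero_pow (by omega)]; omega
    · rw [one_pow]; omega
  · calc (m + 1) ^ 25 ≤ (m * m) ^ 25 := Nat.pow_le_pow_left (by nlinarith) 25
      _ = m ^ 50 := by ring
      _ ≤ m ^ C := Nat.pow_le_pow_right (by omega) hC
      _ ≤ m ^ C + C := Nat.le_add_right _ _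

/-- The numeral fact `50 ≤ 2^25`. [folklore] -/
private theorem fifty_le_two_pow : 50 ≤ 2 ^ 25 := by norm_num

/-- BIP's fresh-padding threshold lies below the quasi-polynomial template with constant `25`:
`(m+1)^25 ≤ 2^((log₂ m + 25)^25)` (`m + 1 ≤ 2^(L+1)`, `L = ⌊log₂ m⌋`, and `25(L+1) ≤ (L+25)^25`).
[folklore] -/
private theorem succ_pow_le_qpTemplate (m : ℕ) : (m + 1) ^ 25 ≤ 2 ^ ((Nat.log 2 m + 25) ^ 25) := by
  have h1 : m < 2 ^ (Nat.log 2 m + 1) := Nat.lt_pow_succ_log_self (by norm_num) m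
  have h2 : (m + 1) ^ 25 ≤ (2 ^ (Nat.log 2 m + 1)) ^ 25 :=
    Nat.pow_le_pow_left (Nat.succ_le_of_lt h1) 25
  rw [← pow_mul] at h2
  refine h2.trans (Nat.pow_le_pow_right (by norm_num) ?_)
  set L := Nat.log 2 m
  calc (L + 1) * 25 ≤ (L + 25) * (L + 25) := by nlinarith
    _ = (L + 25) ^ 2 := (pow_two _).symm
    _ ≤ (L + 25) ^ 25 := Nat.pow_le_pow_right (by omega) (by norm_num)

/-! ### (a) The polynomial hypothesis shape -/

/-- **`MultObstructionsBeyondPoly` can only be met by genuine flips.** If for every `c` some pair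
`(per m, det n)` with `m^c + c ≤ n` carries a multiplicity obstruction `χ`, then for every `c` there
is such a pair whose obstruction ALSO occurs on the determinant side, `0 < mult_χ ℂ[Δ(det_n)]`
(hence `1 ≤ mult_det < mult_per`): instantiate the hypothesis at `max c (2^25)`, where
`n ≥ m^(2^25) + 2^25 ≥ (m+1)^25` and BIP Thm. 1.4 (fresh padding,
`PerDetMultiplicityObstruction.orbitMultiplicity_det_pos`) applies.
[cite: BurgisserIkenmeyerPanovaJAMS2019, Thm. 1.4 and §1.4] -/
theorem MultObstructionsBeyondPoly.genuine (h : MultObstructionsBeyondPoly) (c : ℕ) :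
    ∃ (m n : ℕ) (_ : NeZero n) (χ : Weight (MatIdx n)),
      m ^ c + c ≤ n ∧ PerDetMultiplicityObstruction (k := ℂ) m n χ ∧
        0 < orbitMultiplicity ℂ (detFormLex ℂ n) n χ := by
  obtain ⟨m, n, _, χ, hmn, hobs⟩ := h (max c (2 ^ 25))
  have hc : m ^ c + c ≤ n := (polyTemplate_mono m (le_max_left _ _)).trans hmn
  have h25 : (m + 1) ^ 25 ≤ n :=
    (succ_pow_le_polyTemplate m (fifty_le_two_pow.trans (le_max_right _ _))
      (le_max_right _ _)).trans hmn
  exact ⟨m, n, ‹_›, χ, hc, hobs, hobs.orbitMultiplicity_det_pos h25⟩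

/-- **Equivalence**: `MultObstructionsBeyondPoly` ⟺ its strengthening by determinant-side
occurrence of the witnessing weight. [cite: BurgisserIkenmeyerPanovaJAMS2019, Thm. 1.4 and §1.4] -/
theorem multObstructionsBeyondPoly_iff_genuine :
    MultObstructionsBeyondPoly ↔
      ∀ c : ℕ, ∃ (m n : ℕ) (_ : NeZero n) (χ : Weight (MatIdx n)),
        m ^ c + c ≤ n ∧ PerDetMultiplicityObstruction (k := ℂ) m n χ ∧
          0 < orbitMultiplicity ℂ (detFormLex ℂ n) n χ :=
  ⟨fun h c => h.genuine c, fun h c => by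
    obtain ⟨m, n, _, χ, hmn, hobs, -⟩ := h c
    exact ⟨m, n, ‹_›, χ, hmn, hobs⟩⟩

/-- **The occurrence analogue of `MultObstructionsBeyondPoly` is false**: there is no family, one
pair `(per m, det n)` with `m^c + c ≤ n` per constant `c`, of OCCURRENCE obstructions
(`mult_χ ℂ[Δ(det_n)] = 0 < mult_χ ℂ[Δ(X₀₀^{n-m} per_m)]`) — at `c = 2^25` the template forces
`(m+1)^25 ≤ n`, where BIP Thm. 1.4 leaves none
(`not_isOccurrenceObstructionAt_perDet_of_succ_pow_le`). The negand is spelled out; nothing is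
declared. [cite: BurgisserIkenmeyerPanovaJAMS2019, Thm. 1.4] -/
theorem not_occurrenceObstructionsBeyondPoly :
    ¬ ∀ c : ℕ, ∃ (m n : ℕ) (_ : NeZero n) (χ : Weight (MatIdx n)),
      m ^ c + c ≤ n ∧ IsOccurrenceObstructionAt (detFormLex ℂ n) (paddedPerFormLex ℂ m n) n χ := by
  intro h
  obtain ⟨m, n, _, χ, hmn, hocc⟩ := h (2 ^ 25)
  exact not_isOccurrenceObstructionAt_perDet_of_succ_pow_le
    ((succ_pow_le_polyTemplate m fifty_le_two_pow le_rfl).trans hmn) χ hocc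

/-! ### (b) The quasi-polynomial hypothesis shape -/

/-- **`MultObstructionsBeyondQuasiPoly` can only be met by genuine flips**: for every `c` there is a
pair `(per m, det n)` with `2^((log₂ m + c)^c) ≤ n` whose obstruction occurs on the determinant side
too (instantiate at `max c 25`, where `n ≥ 2^((log₂ m + 25)^25) ≥ (m+1)^25`).
[cite: BurgisserIkenmeyerPanovaJAMS2019, Thm. 1.4 and §1.4] -/
theorem MultObstructionsBeyondQuasiPoly.genuine (h : MultObstructionsBeyondQuasiPoly) (c : ℕ) :
    ∃ (m n : ℕ) (_ : NeZero n) (χ : Weight (MatIdx n)),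
      2 ^ ((Nat.log 2 m + c) ^ c) ≤ n ∧ PerDetMultiplicityObstruction (k := ℂ) m n χ ∧
        0 < orbitMultiplicity ℂ (detFormLex ℂ n) n χ := by
  obtain ⟨m, n, _, χ, hmn, hobs⟩ := h (max c 25)
  have hc : 2 ^ ((Nat.log 2 m + c) ^ c) ≤ n := (qpTemplate_mono m (le_max_left _ _)).trans hmn
  have h25 : (m + 1) ^ 25 ≤ n :=
    (succ_pow_le_qpTemplate m).trans ((qpTemplate_mono m (le_max_right _ _)).trans hmn)
  exact ⟨m, n, ‹_›, χ, hc, hobs, hobs.orbitMultiplicity_det_pos h25⟩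

/-- **Equivalence**: `MultObstructionsBeyondQuasiPoly` ⟺ its strengthening by determinant-side
occurrence of the witnessing weight. [cite: BurgisserIkenmeyerPanovaJAMS2019, Thm. 1.4 and §1.4] -/
theorem multObstructionsBeyondQuasiPoly_iff_genuine :
    MultObstructionsBeyondQuasiPoly ↔
      ∀ c : ℕ, ∃ (m n : ℕ) (_ : NeZero n) (χ : Weight (MatIdx n)),
        2 ^ ((Nat.log 2 m + c) ^ c) ≤ n ∧ PerDetMultiplicityObstruction (k := ℂ) m n χ ∧
          0 < orbitMultiplicity ℂ (detFormLex ℂ n) n χ :=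
  ⟨fun h c => h.genuine c, fun h c => by
    obtain ⟨m, n, _, χ, hmn, hobs, -⟩ := h c
    exact ⟨m, n, ‹_›, χ, hmn, hobs⟩⟩

/-- **The kinds of obstruction that can feed `SufficesForVPneVNP`**: under
`MultObstructionsBeyondQuasiPoly`, for every `c` there is a pair beyond the template whose
obstruction is a vanishing ideal occurrence obstruction or a pure multiplicity obstruction
(typology of `ObstructionTypes.lean`), and not an occurrence obstruction
(`PerDetMultiplicityObstruction.isVanishingIdealOccurrence_or_pure`).
[cite: BurgisserIkenmeyerPanovaJAMS2019, Thm. 1.4 and §1.4] -/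
theorem MultObstructionsBeyondQuasiPoly.kinds (h : MultObstructionsBeyondQuasiPoly) (c : ℕ) :
    ∃ (m n : ℕ) (_ : NeZero n) (χ : Weight (MatIdx n)),
      2 ^ ((Nat.log 2 m + c) ^ c) ≤ n ∧ PerDetMultiplicityObstruction (k := ℂ) m n χ ∧
        ¬ IsOccurrenceObstructionAt (detFormLex ℂ n) (paddedPerFormLex ℂ m n) n χ ∧
        (IsVanishingIdealOccurrenceObstructionAt (detFormLex ℂ n) (paddedPerFormLex ℂ m n) n χ ∨
          IsPureMultiplicityObstructionAt (detFormLex ℂ n) (paddedPerFormLex ℂ m n) n χ) := by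
  obtain ⟨m, n, _, χ, hmn, hobs⟩ := h (max c 25)
  have hc : 2 ^ ((Nat.log 2 m + c) ^ c) ≤ n := (qpTemplate_mono m (le_max_left _ _)).trans hmn
  have h25 : (m + 1) ^ 25 ≤ n :=
    (succ_pow_le_qpTemplate m).trans ((qpTemplate_mono m (le_max_right _ _)).trans hmn)
  exact ⟨m, n, ‹_›, χ, hc, hobs, hobs.not_isOccurrenceObstructionAt h25,
    hobs.isVanishingIdealOccurrence_or_pure h25⟩

/-- **The occurrence analogue of `MultObstructionsBeyondQuasiPoly` is false** — refuted at
`c = 25`, where the template forces `(m+1)^25 ≤ n`. So `VP_ℂ ≠ VNP_ℂ` cannot be reached through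
`sufficesForVPneVNP_holds` by occurrence obstructions (for this padding and these orbit closures);
the negand is spelled out, nothing is declared. [cite: BurgisserIkenmeyerPanovaJAMS2019, Thm. 1.4] -/
theorem not_occurrenceObstructionsBeyondQuasiPoly :
    ¬ ∀ c : ℕ, ∃ (m n : ℕ) (_ : NeZero n) (χ : Weight (MatIdx n)),
      2 ^ ((Nat.log 2 m + c) ^ c) ≤ n ∧
        IsOccurrenceObstructionAt (detFormLex ℂ n) (paddedPerFormLex ℂ m n) n χ := by
  intro h
  obtain ⟨m, n, _, χ, hmn, hocc⟩ := h 25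
  exact not_isOccurrenceObstructionAt_perDet_of_succ_pow_le
    ((succ_pow_le_qpTemplate m).trans hmn) χ hocc

/-- **The two readings side by side**: the quasi-polynomial hypothesis of `SufficesForVPneVNP`
holds iff it holds with genuine flips, while its occurrence reading is refuted — the dc-language
record of BIP's "we do not rule out the general approach … via multiplicity obstructions"
(abstract) next to "this approach is impossible" (for occurrence obstructions).
[cite: BurgisserIkenmeyerPanovaJAMS2019, Thm. 1.4 and §1.4] -/
theorem sufficesForVPneVNP_inputs :
    (MultObstructionsBeyondQuasiPoly ↔
      ∀ c : ℕ, ∃ (m n : ℕ) (_ : NeZero n) (χ : Weight (MatIdx n)),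
        2 ^ ((Nat.log 2 m + c) ^ c) ≤ n ∧ PerDetMultiplicityObstruction (k := ℂ) m n χ ∧
          0 < orbitMultiplicity ℂ (detFormLex ℂ n) n χ) ∧
    ¬ (∀ c : ℕ, ∃ (m n : ℕ) (_ : NeZero n) (χ : Weight (MatIdx n)),
      2 ^ ((Nat.log 2 m + c) ^ c) ≤ n ∧
        IsOccurrenceObstructionAt (detFormLex ℂ n) (paddedPerFormLex ℂ m n) n χ) :=
  ⟨multObstructionsBeyondQuasiPoly_iff_genuine, not_occurrenceObstructionsBeyondQuasiPoly⟩

end Summit.PneNP.GCT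

end
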